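import Literature.NumberTheory.EllipticCurves.IwasawaAlgebra
import Mathlib.NumberTheory.Padics.Complex
import HarnessLib

/-!
# λ-rigidity of divisibilities in `R⟦T⟧` over a local ring: `A ∣ B` with `λ(B) ≤ λ(A)` and `μ(B) = 0` is an equality
# `(A) = (B)` (cofactor a unit) — generic `R`, `Λ = ℤ_p⟦T⟧` (`IwasawaAlgebra p`) and `𝒪_{ℂ_p}⟦T⟧`

Topic `NumberTheory/EllipticCurves`, namespace `Literature.NumberTheory.EllipticCurves.PowerSeriesLambdaRigidity` (THEOREMS ONLY:
no definition, no named fact, no `sorry`).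

For a local ring `R` with residue field `k`, reduction `R⟦T⟧ → k⟦T⟧` sends a series `A` to `Ā`; `A` has `μ = 0`
("unit content", the tree's `HasUnitContent A := ∃ n, IsUnit ([Tⁿ]A)`) iff `Ā ≠ 0`, and then `λ(A) := ord_T Ā` = the index of
the FIRST unit coefficient. Since `k⟦T⟧` is a domain, `B = A·C` gives `ord_T B̄ = ord_T Ā + ord_T C̄`; so if `B` has a unit
coefficient in degree `≤ k` while all coefficients of `A` below `k` are non-units (`λ(B) ≤ k ≤ λ(A)`), then `ord_T C̄ = 0`, i.e.
`C(0) ∈ Rˣ`, i.e. `C ∈ R⟦T⟧ˣ` — the divisibility is an equality of ideals. This is the standard companion of Weierstrass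
preparation («a divisibility between elements of `Λ` with the same Iwasawa invariants is an equality», used to turn one-sided
main-conjecture divisibilities into equalities); the tree had the `μ`-half (`hasUnitContent_mul_iff_of_isUnit`,
`hasUnitContent_iff_map_residue_ne_zero`) and degree readouts on `Λ` (`order_map_residue_le_of_isUnit_coeff`), not the rigidity.

Contents (all `[CommRing R] [IsLocalRing R]`; in particular `R = ℤ_[p]` — `IwasawaAlgebra p = PowerSeries ℤ_[p]` — and
`R = 𝒪_{ℂ_p}` = `PadicComplexInt p`):
* §1 degree bookkeeping of the reduction: `order_map_residue_le_of_isUnit_coeff`, `le_order_map_residue_of_forall_not_isUnit_coeff`,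
  `map_residue_ne_zero_of_isUnit_coeff`, `isUnit_iff_order_map_residue_eq_zero`;
* §2 ★ `exists_isUnit_mul_eq_of_dvd` (the cofactor is a unit), `dvd_of_dvd` (two-sided divisibility), `span_singleton_eq_of_dvd`
  (`(A) = (B)`), `le_span_singleton_iff_of_dvd` (containments `J ≤ (A)` transfer), and the reading for EQUAL first-unit index
  `span_singleton_eq_of_dvd_of_isUnit_coeff_of_forall`;
* §3 the two instances the BSD cells use: `IwasawaAlgebra p` and `PowerSeries (PadicComplexInt p)` (one-liners, so that
  consumers see the statement in their own currency).

Companion file (same seat): `IntSeriesOnePointRigidity` — the VALUE form (`‖A(x)‖ = ‖B(x)‖ ≠ 0` at one interior point) over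
`𝒪_{ℂ_p}`. [cite: Washington1997, §7.1 (Weierstrass preparation, distinguished polynomials; units of `Λ`)]
[cite: GreenbergVatsal2000, p. 2, (2) (`μ`, `λ` of a power series via its reduction)]
-/

noncomputable section

open scoped Classical
open PowerSeries

namespace Literature.NumberTheory.EllipticCurves.PowerSeriesLambdaRigidity

variable {R : Type*} [CommRing R] [IsLocalRing R]

/-! ### §1. Degrees of the reduction modulo the maximal ideal -/

/-- A unit coefficient survives reduction: `IsUnit ([T^k]A) → [T^k]Ā ≠ 0`. [cite: GreenbergVatsal2000, p. 2, (2)] -/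
theorem coeff_map_residue_ne_zero_of_isUnit_coeff {A : PowerSeries R} {k : ℕ} (hu : IsUnit (coeff k A)) :
    coeff k (PowerSeries.map (IsLocalRing.residue R) A) ≠ 0 := by
  rw [coeff_map]
  exact (IsLocalRing.residue_ne_zero_iff_isUnit _).mpr hu

/-- A unit coefficient in degree `k` bounds the order of the reduction: `ord_T Ā ≤ k` ("`λ(A) ≤ k`").
[cite: GreenbergVatsal2000, p. 2, (2)] -/
theorem order_map_residue_le_of_isUnit_coeff {A : PowerSeries R} {k : ℕ} (hu : IsUnit (coeff k A)) :
    (PowerSeries.map (IsLocalRing.residue R) A).order ≤ k :=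
  order_le k (coeff_map_residue_ne_zero_of_isUnit_coeff hu)

/-- A unit coefficient makes the reduction non-zero ("`μ(A) = 0`"). [cite: GreenbergVatsal2000, p. 2, (2)] -/
theorem map_residue_ne_zero_of_isUnit_coeff {A : PowerSeries R} {k : ℕ} (hu : IsUnit (coeff k A)) :
    PowerSeries.map (IsLocalRing.residue R) A ≠ 0 := by
  intro h
  exact coeff_map_residue_ne_zero_of_isUnit_coeff hu (by rw [h, map_zero])

/-- Non-unit coefficients below `k` force `k ≤ ord_T Ā` ("`k ≤ λ(A)`"). [cite: GreenbergVatsal2000, p. 2, (2)] -/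
theorem le_order_map_residue_of_forall_not_isUnit_coeff {A : PowerSeries R} {k : ℕ}
    (hA : ∀ j < k, ¬ IsUnit (coeff j A)) : (k : ℕ∞) ≤ (PowerSeries.map (IsLocalRing.residue R) A).order := by
  refine nat_le_order _ k fun j hj => ?_
  rw [coeff_map]
  by_contra h
  exact hA j hj ((IsLocalRing.residue_ne_zero_iff_isUnit _).mp h)

/-- **Units of `R⟦T⟧` are the series whose reduction has order `0`** (`C ∈ R⟦T⟧ˣ ⟺ C(0) ∈ Rˣ ⟺ C̄(0) ≠ 0`).
[cite: Washington1997, §7.1] -/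
theorem isUnit_iff_coeff_zero_map_residue_ne_zero (C : PowerSeries R) :
    IsUnit C ↔ coeff 0 (PowerSeries.map (IsLocalRing.residue R) C) ≠ 0 := by
  rw [PowerSeries.isUnit_iff_constantCoeff, coeff_map, coeff_zero_eq_constantCoeff,
    IsLocalRing.residue_ne_zero_iff_isUnit]

/-- In particular `ord_T C̄ = 0` (for `C̄ ≠ 0`) makes `C` a unit. [cite: Washington1997, §7.1] -/
theorem isUnit_of_order_map_residue_eq_zero {C : PowerSeries R}
    (hC0 : PowerSeries.map (IsLocalRing.residue R) C ≠ 0)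
    (h : (PowerSeries.map (IsLocalRing.residue R) C).order = 0) : IsUnit C := by
  rw [isUnit_iff_coeff_zero_map_residue_ne_zero]
  have h' := coeff_order hC0
  rwa [h, ENat.toNat_zero] at h'

/-! ### §2. λ-rigidity: the cofactor of a divisibility with `λ(B) ≤ λ(A)`, `μ(B) = 0` is a unit -/

/-- ★ **λ-rigidity (unit form).** Let `R` be a local ring and `A ∣ B` in `R⟦T⟧`. If every coefficient of `A` in degree
`< k` is a non-unit (`k ≤ λ(A)`) and `B` has a unit coefficient in some degree `≤ k` (`μ(B) = 0`, `λ(B) ≤ k`), then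
`B = A·U` with `U` a UNIT. Proof: reduce to the domain `k⟦T⟧`: `ord B̄ = ord Ā + ord C̄ ≥ k + ord C̄` and `ord B̄ ≤ k` give
`ord C̄ = 0`, i.e. `C(0) ∈ Rˣ`. [cite: Washington1997, §7.1] -/
theorem exists_isUnit_mul_eq_of_dvd {A B : PowerSeries R} (hAB : A ∣ B) {k : ℕ}
    (hA : ∀ j < k, ¬ IsUnit (coeff j A)) (hB : ∃ j ≤ k, IsUnit (coeff j B)) :
    ∃ U : PowerSeries R, IsUnit U ∧ B = A * U := by
  obtain ⟨C, rfl⟩ := hAB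
  obtain ⟨j, hjk, hj⟩ := hB
  refine ⟨C, ?_, rfl⟩
  set φ := IsLocalRing.residue R with hφ
  have hBbar : PowerSeries.map φ (A * C) ≠ 0 := map_residue_ne_zero_of_isUnit_coeff hj
  have hmul : PowerSeries.map φ (A * C) = PowerSeries.map φ A * PowerSeries.map φ C := map_mul _ _ _
  have hCbar : PowerSeries.map φ C ≠ 0 := by
    intro h
    exact hBbar (by rw [hmul, h, mul_zero])
  -- order bookkeeping in `k⟦T⟧`
  have hordB : (PowerSeries.map φ (A * C)).order ≤ j := order_map_residue_le_of_isUnit_coeff hj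
  have hordA : (k : ℕ∞) ≤ (PowerSeries.map φ A).order := le_order_map_residue_of_forall_not_isUnit_coeff hA
  have hsum : (PowerSeries.map φ (A * C)).order = (PowerSeries.map φ A).order + (PowerSeries.map φ C).order := by
    rw [hmul, order_mul]
  have hCfin : (PowerSeries.map φ C).order ≠ ⊤ := by rwa [ne_eq, order_eq_top]
  have hAfin : (PowerSeries.map φ A).order ≠ ⊤ := by
    rw [ne_eq, order_eq_top]
    intro h
    exact hBbar (by rw [hmul, h, zero_mul])
  obtain ⟨a, ha⟩ := ENat.ne_top_iff_exists.mp hAfin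
  obtain ⟨c, hc⟩ := ENat.ne_top_iff_exists.mp hCfin
  have hjk' : (j : ℕ∞) ≤ k := by exact_mod_cast hjk
  have hle : (PowerSeries.map φ A).order + (PowerSeries.map φ C).order ≤ k := hsum ▸ hordB.trans hjk'
  rw [← ha, ← hc] at hle
  rw [← ha] at hordA
  have hc0 : c = 0 := by
    have h1 : ((a + c : ℕ) : ℕ∞) ≤ k := by push_cast; exact hle
    have h2 : (k : ℕ∞) ≤ a := hordA
    have h1' : a + c ≤ k := by exact_mod_cast h1
    have h2' : k ≤ a := by exact_mod_cast h2
    omega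
  refine isUnit_of_order_map_residue_eq_zero hCbar ?_
  rw [← hc, hc0]
  rfl

/-- ★ **λ-rigidity (two-sided divisibility).** Under the same hypotheses `B ∣ A`. [cite: Washington1997, §7.1] -/
theorem dvd_of_dvd {A B : PowerSeries R} (hAB : A ∣ B) {k : ℕ}
    (hA : ∀ j < k, ¬ IsUnit (coeff j A)) (hB : ∃ j ≤ k, IsUnit (coeff j B)) : B ∣ A := by
  obtain ⟨U, hU, rfl⟩ := exists_isUnit_mul_eq_of_dvd hAB hA hB
  obtain ⟨u, rfl⟩ := hU
  exact ⟨((u⁻¹ : (PowerSeries R)ˣ) : PowerSeries R), by rw [mul_assoc, Units.mul_inv, mul_one]⟩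

/-- ★ **λ-rigidity (ideal form).** A divisibility `A ∣ B` in `R⟦T⟧` (`R` local) with `λ(B) ≤ k ≤ λ(A)` and `μ(B) = 0` — all
coefficients of `A` below `k` non-units, some coefficient of `B` in degree `≤ k` a unit — is an EQUALITY of ideals `(A) = (B)`.
[cite: Washington1997, §7.1] -/
theorem span_singleton_eq_of_dvd {A B : PowerSeries R} (hAB : A ∣ B) {k : ℕ}
    (hA : ∀ j < k, ¬ IsUnit (coeff j A)) (hB : ∃ j ≤ k, IsUnit (coeff j B)) :
    Ideal.span ({A} : Set (PowerSeries R)) = Ideal.span {B} :=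
  le_antisymm (Ideal.span_singleton_le_span_singleton.mpr (dvd_of_dvd hAB hA hB))
    (Ideal.span_singleton_le_span_singleton.mpr hAB)

/-- **Transfer of containments** (the consumer shape `J ≤ (Q)` of the BSD cells' heart statements): under λ-rigidity,
`J ≤ (A) ↔ J ≤ (B)` for every ideal `J`. [cite: Washington1997, §7.1] -/
theorem le_span_singleton_iff_of_dvd {A B : PowerSeries R} (hAB : A ∣ B) {k : ℕ}
    (hA : ∀ j < k, ¬ IsUnit (coeff j A)) (hB : ∃ j ≤ k, IsUnit (coeff j B)) (J : Ideal (PowerSeries R)) :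
    J ≤ Ideal.span {A} ↔ J ≤ Ideal.span {B} := by
  rw [span_singleton_eq_of_dvd hAB hA hB]

/-- **The EQUAL-λ reading**: `A ∣ B`, the first unit coefficient of `A` sits in degree `k` or beyond (`¬ IsUnit [T^j]A` for
`j < k`) and `[T^k]B` is a unit ⟹ `(A) = (B)`. [cite: Washington1997, §7.1] -/
theorem span_singleton_eq_of_dvd_of_isUnit_coeff {A B : PowerSeries R} (hAB : A ∣ B) {k : ℕ}
    (hA : ∀ j < k, ¬ IsUnit (coeff j A)) (hB : IsUnit (coeff k B)) :
    Ideal.span ({A} : Set (PowerSeries R)) = Ideal.span {B} :=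
  span_singleton_eq_of_dvd hAB hA ⟨k, le_rfl, hB⟩

/-- **The `λ = 0` reading** (no hypothesis on `A`): if `A ∣ B` and the constant term of `B` is a unit, then `A` and the
cofactor are units and `(A) = (B) = R⟦T⟧`. [cite: Washington1997, §7.1] -/
theorem span_singleton_eq_of_dvd_of_isUnit_constantCoeff {A B : PowerSeries R} (hAB : A ∣ B)
    (hB : IsUnit (constantCoeff B)) : Ideal.span ({A} : Set (PowerSeries R)) = Ideal.span {B} :=
  span_singleton_eq_of_dvd hAB (k := 0) (fun _ hj => absurd hj (Nat.not_lt_zero _))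
    ⟨0, le_rfl, by rwa [coeff_zero_eq_constantCoeff]⟩

/-- **Strict λ-drop detects a non-unit cofactor**: if all coefficients of `A` below `k` are non-units but `A·C` has a unit
coefficient in degree `< k`, contradiction — equivalently, multiplying by ANY `C` cannot lower the first-unit index:
`(∀ j < k, ¬ IsUnit [T^j]A) → ∀ j < k, ¬ IsUnit [T^j](A·C)`. [cite: Washington1997, §7.1] -/
theorem not_isUnit_coeff_mul_of_forall_not_isUnit_coeff {A : PowerSeries R} (C : PowerSeries R) {k : ℕ}
    (hA : ∀ j < k, ¬ IsUnit (coeff j A)) : ∀ j < k, ¬ IsUnit (coeff j (A * C)) := by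
  intro j hj hu
  have hle : (PowerSeries.map (IsLocalRing.residue R) (A * C)).order ≤ j := order_map_residue_le_of_isUnit_coeff hu
  have hge : (k : ℕ∞) ≤ (PowerSeries.map (IsLocalRing.residue R) (A * C)).order := by
    rw [map_mul]
    exact (le_order_map_residue_of_forall_not_isUnit_coeff hA).trans (le_self_add.trans_eq (order_mul _ _).symm)
  have : (k : ℕ∞) ≤ j := hge.trans hle
  exact (lt_irrefl _) ((show k ≤ j by exact_mod_cast this).trans_lt hj |>.trans_le le_rfl)

/-! ### §3. The two instances used by the BSD cells -/

/-- **λ-rigidity in `Λ = ℤ_p⟦T⟧`** (`IwasawaAlgebra p`): `A ∣ B`, `p ∣ [T^j]A` for `j < k`, `[T^j]B ∈ ℤ_pˣ` for some `j ≤ k`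
⟹ `(A) = (B)`. [cite: Washington1997, §7.1] -/
theorem iwasawaAlgebra_span_singleton_eq_of_dvd {p : ℕ} [Fact p.Prime] {A B : IwasawaAlgebra p} (hAB : A ∣ B) {k : ℕ}
    (hA : ∀ j < k, ¬ IsUnit (coeff j A)) (hB : ∃ j ≤ k, IsUnit (coeff j B)) :
    Ideal.span ({A} : Set (IwasawaAlgebra p)) = Ideal.span {B} :=
  span_singleton_eq_of_dvd hAB hA hB

/-- **λ-rigidity in `𝒪_{ℂ_p}⟦T⟧`**: `A ∣ B`, `‖[T^j]A‖ < 1` for `j < k`, `‖[T^j]B‖ = 1` for some `j ≤ k` ⟹ `(A) = (B)`.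
[cite: Washington1997, §7.1] -/
theorem padicComplexInt_span_singleton_eq_of_dvd {p : ℕ} [Fact p.Prime] {A B : PowerSeries (PadicComplexInt p)}
    (hAB : A ∣ B) {k : ℕ} (hA : ∀ j < k, ¬ IsUnit (coeff j A)) (hB : ∃ j ≤ k, IsUnit (coeff j B)) :
    Ideal.span ({A} : Set (PowerSeries (PadicComplexInt p))) = Ideal.span {B} :=
  span_singleton_eq_of_dvd hAB hA hB

end Literature.NumberTheory.EllipticCurves.PowerSeriesLambdaRigidity

end
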